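import Summits.RiemannHypothesis.RiemannHypothesis.Theorems.NymanBeurlingTailLeverage
import Summits.RiemannHypothesis.RiemannHypothesis.Theorems.NymanBeurlingQDigitsKernel
import Literature.Analysis.SpecialFunctions.KernelLog
import Mathlib.NumberTheory.ArithmeticFunction.Moebius
import HarnessLib

/-!
# RiemannHypothesis / Nyman–Beurling — LEVINSON IS FAR FROM OPTIMAL AT `N = 2000`, in the kernel:
# `0.0166 ≤ d²_2000(v_2000)` (theory target `NbLevinsonFarFromOptimal`, numeric conjunct; RH-FREE, kernel-certified)

Column LI/NB, rung L-P(P2) «structure of the NB minimiser», PROOF-OF-DATA for cell `pub/rh-li` [rh-li-eng-3 g5].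
Theory (`theory/NBHeadTail.lean`, T6 `NbLevinsonFarFromOptimal`): for the Levinson / Bettin–Conrey–Farmer vector
`v_a = −μ(a)(1 − log a/log N)` (`nbLevinsonVector`), `d_N²(v_N) ≥ (2 − 2 log²2)·tailConst(v_N)²` (landed, `nbTailConstLeDist`)
and at `N = 2000` this is `≥ 0.0166`, against the certified optimum `d²_2000 = 0.006114…` (DATA.md §L, lineages R/A):
the asymptotically optimal mollifier is `≥ 2.7×` worse than the minimiser at accessible `N`.  The `∀N` conjunct is
`nbTailConstLeDist`; this file certifies the numeric instance:

* `tailConst(v_N) = −(1/log N) Σ_{a≤N} μ(a) log(N/a)/a` (`nbLevinsonTailConst`, landed);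
* `wAcc` — kernel-evaluable outward-rounded enclosure (scale `2⁸⁰`) of `W = Σ_{a≤2000} μ(a)(log 2000 − log a)/a`, with
  `μ = ArithmeticFunction.moebius` EVALUATED BY THE KERNEL and the logarithms from the tree's `KernelLog.logIv`
  (`logIv_sound`); soundness `wAcc_sound`; test `levCheck_eq` (`decide +kernel`): `0.0166·(2⁸⁰ log 2000)² ≤ (2 − 2·0.6931…944²)·W_lo²`;
* `nbDistSq_levinson_two_thousand_ge` — **`0.0166 ≤ nbDistSq 2000 (nbLevinsonVector 2000)`**;
  `nbLevinsonFarFromOptimal_holds` — theory's T6, both conjuncts.  (Float: `W = 0.99981`, `τ·log N = −0.99981`, bound `0.01798`.)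
RH-FREE [rh-li-eng-3 g5]: certified numerics about a finite Dirichlet polynomial; nothing here bears on the truth of RH.
-/

noncomputable section

set_option linter.dupNamespace false

open Filter Set Finset
open scoped Real

namespace Summit.RiemannHypothesis.RiemannHypothesis.Theorems.NbTheory

open Literature.NumberTheory.LFunctions Literature.NumberTheory.LFunctions.BaezDuarteOnlyIf
  Literature.Analysis.SpecialFunctions.KernelLog

namespace LevinsonCert

/-- Outward-rounded enclosure (scale `2⁸⁰`) of `Σ_{a=1}^{k} μ(a)(log N − log a)/a`, given an enclosure `[nl, nh]` of
`2⁸⁰ log N`; `μ` is Mathlib's `ArithmeticFunction.moebius`, evaluated by the kernel. -/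
def wAcc (nl nh : ℤ) : ℕ → Option (ℤ × ℤ)
  | 0 => some (0, 0)
  | k + 1 =>
    match wAcc nl nh k, logIv (k + 1) with
    | some (a, b), some (al, ah) =>
      if (ArithmeticFunction.moebius (k + 1) : ℤ) = 1 then
        some (a + (nl - ah) / ((k : ℤ) + 1), b + -((-(nh - al)) / ((k : ℤ) + 1)))
      else if (ArithmeticFunction.moebius (k + 1) : ℤ) = -1 then
        some (a + (-(nh - al)) / ((k : ℤ) + 1), b + -((nl - ah) / ((k : ℤ) + 1)))
      else some (a, b)
    | _, _ => none

/-- **Soundness of `wAcc`.** -/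
theorem wAcc_sound {N : ℕ} {nl nh : ℤ} (hN : (nl : ℝ) / 2 ^ 80 ≤ Real.log N ∧ Real.log N ≤ (nh : ℝ) / 2 ^ 80) :
    ∀ (k : ℕ) {a b : ℤ}, wAcc nl nh k = some (a, b) →
      (a : ℝ) / 2 ^ 80 ≤ ∑ i ∈ Finset.range k,
          (ArithmeticFunction.moebius (i + 1) : ℝ) * (Real.log N - Real.log ((i : ℝ) + 1)) / ((i : ℝ) + 1) ∧
        ∑ i ∈ Finset.range k,
          (ArithmeticFunction.moebius (i + 1) : ℝ) * (Real.log N - Real.log ((i : ℝ) + 1)) / ((i : ℝ) + 1) ≤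
          (b : ℝ) / 2 ^ 80
  | 0, a, b, h => by
    simp only [wAcc, Option.some.injEq, Prod.mk.injEq] at h
    obtain ⟨rfl, rfl⟩ := h
    simp
  | k + 1, a, b, h => by
    unfold wAcc at h
    cases hK : wAcc nl nh k with
    | none => simp [hK] at h
    | some p =>
      obtain ⟨a', b'⟩ := p
      cases hL : logIv (k + 1) with
      | none => simp [hK, hL] at h
      | some q =>
        obtain ⟨al, ah⟩ := q
        simp only [hK, hL] at h
        obtain ⟨ih1, ih2⟩ := wAcc_sound hN k hK
        obtain ⟨hal, hah⟩ := logIv_sound hL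
        have hk1 : ((k + 1 : ℕ) : ℝ) = (k : ℝ) + 1 := by push_cast; ring
        rw [hk1] at hal hah
        have hS : (0 : ℝ) < (2 : ℝ) ^ 80 := by positivity
        have hkpos : (0 : ℝ) < (k : ℝ) + 1 := by positivity
        have hd : (0 : ℤ) < (k : ℤ) + 1 := by positivity
        have hdR : ((((k : ℤ) + 1 : ℤ)) : ℝ) = (k : ℝ) + 1 := by push_cast; ring
        -- the scaled difference `D = log N − log(k+1)` satisfies `(nl − ah)/S ≤ D ≤ (nh − al)/S`
        set D := Real.log N - Real.log ((k : ℝ) + 1) with hD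
        have hDlo : ((nl - ah : ℤ) : ℝ) / 2 ^ 80 ≤ D := by push_cast; rw [sub_div]; linarith [hN.1]
        have hDhi : D ≤ ((nh - al : ℤ) : ℝ) / 2 ^ 80 := by push_cast; rw [sub_div]; linarith [hN.2]
        -- floor/ceiling of `D/(k+1)` and of `−D/(k+1)`
        have hfl := (ediv_bounds_real (nl - ah) ((k : ℤ) + 1) hd).1
        have hce := (ediv_bounds_real (-(nh - al)) ((k : ℤ) + 1) hd).1
        have hfl2 := (ediv_bounds_real (-(nh - al)) ((k : ℤ) + 1) hd).1
        have hce2 := (ediv_bounds_real (nl - ah) ((k : ℤ) + 1) hd).1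
        rw [hdR] at hfl hce hfl2 hce2
        rw [Finset.sum_range_succ]
        -- value bounds for `D/(k+1)`
        have hlo' : (((nl - ah) / ((k : ℤ) + 1) : ℤ) : ℝ) / 2 ^ 80 ≤ D / ((k : ℝ) + 1) := by
          rw [div_le_iff₀ hS]
          calc (((nl - ah) / ((k : ℤ) + 1) : ℤ) : ℝ) ≤ ((nl - ah : ℤ) : ℝ) / ((k : ℝ) + 1) := hfl
            _ ≤ D * 2 ^ 80 / ((k : ℝ) + 1) := by
                refine div_le_div_of_nonneg_right ?_ hkpos.le
                rw [div_le_iff₀ hS] at hDlo; exact hDlo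
            _ = D / ((k : ℝ) + 1) * 2 ^ 80 := by ring
        have hhi' : D / ((k : ℝ) + 1) ≤ (((-((-(nh - al)) / ((k : ℤ) + 1))) : ℤ) : ℝ) / 2 ^ 80 := by
          rw [le_div_iff₀ hS]
          push_cast
          have h1 : (((-(nh - al)) / ((k : ℤ) + 1) : ℤ) : ℝ) ≤ ((-(nh - al) : ℤ) : ℝ) / ((k : ℝ) + 1) := hce
          have h2 : ((-(nh - al) : ℤ) : ℝ) / ((k : ℝ) + 1) = -(((nh - al : ℤ) : ℝ) / ((k : ℝ) + 1)) := by
            push_cast; ring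
          have h3 : D * 2 ^ 80 ≤ ((nh - al : ℤ) : ℝ) := by rw [le_div_iff₀ hS] at hDhi; exact hDhi
          have h4 : D * 2 ^ 80 / ((k : ℝ) + 1) ≤ ((nh - al : ℤ) : ℝ) / ((k : ℝ) + 1) :=
            div_le_div_of_nonneg_right h3 hkpos.le
          have h5 : D / ((k : ℝ) + 1) * 2 ^ 80 = D * 2 ^ 80 / ((k : ℝ) + 1) := by ring
          push_cast at h1 h2 h4 ⊢
          linarith
        split_ifs at h with hμ1 hμ2
        · simp only [Option.some.injEq, Prod.mk.injEq] at h
          obtain ⟨rfl, rfl⟩ := h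
          have hμR : (ArithmeticFunction.moebius (k + 1) : ℝ) = 1 := by exact_mod_cast hμ1
          rw [hμR, one_mul, Int.cast_add, Int.cast_add, add_div, add_div]
          exact ⟨by linarith, by linarith⟩
        · simp only [Option.some.injEq, Prod.mk.injEq] at h
          obtain ⟨rfl, rfl⟩ := h
          have hμR : (ArithmeticFunction.moebius (k + 1) : ℝ) = -1 := by exact_mod_cast hμ2
          rw [hμR, Int.cast_add, Int.cast_add, add_div, add_div]
          -- term `= −D/(k+1)`, enclosed by `[(−(nh−al))/(k+1), −((nl−ah)/(k+1))]`
          have hlo2 : ((((-(nh - al)) / ((k : ℤ) + 1)) : ℤ) : ℝ) / 2 ^ 80 ≤ -1 * D / ((k : ℝ) + 1) := by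
            rw [div_le_iff₀ hS]
            have h3 : D * 2 ^ 80 ≤ ((nh - al : ℤ) : ℝ) := by rw [le_div_iff₀ hS] at hDhi; exact hDhi
            have h4 : ((-(nh - al) : ℤ) : ℝ) / ((k : ℝ) + 1) ≤ -(D * 2 ^ 80) / ((k : ℝ) + 1) := by
              refine div_le_div_of_nonneg_right ?_ hkpos.le
              push_cast; linarith
            calc ((((-(nh - al)) / ((k : ℤ) + 1)) : ℤ) : ℝ) ≤ ((-(nh - al) : ℤ) : ℝ) / ((k : ℝ) + 1) := hfl2
              _ ≤ -(D * 2 ^ 80) / ((k : ℝ) + 1) := h4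
              _ = -1 * D / ((k : ℝ) + 1) * 2 ^ 80 := by ring
          have hhi2 : -1 * D / ((k : ℝ) + 1) ≤ (((-((nl - ah) / ((k : ℤ) + 1))) : ℤ) : ℝ) / 2 ^ 80 := by
            rw [le_div_iff₀ hS]
            push_cast
            have h3 : ((nl - ah : ℤ) : ℝ) ≤ D * 2 ^ 80 := by rw [div_le_iff₀ hS] at hDlo; exact hDlo
            have h4 : ((nl - ah : ℤ) : ℝ) / ((k : ℝ) + 1) ≤ D * 2 ^ 80 / ((k : ℝ) + 1) :=
              div_le_div_of_nonneg_right h3 hkpos.le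
            push_cast at hce2 h4 ⊢
            have h5 : -1 * D / ((k : ℝ) + 1) * 2 ^ 80 = -(D * 2 ^ 80 / ((k : ℝ) + 1)) := by ring
            linarith
          exact ⟨by linarith, by linarith⟩
        · simp only [Option.some.injEq, Prod.mk.injEq] at h
          obtain ⟨rfl, rfl⟩ := h
          have hμ0 : (ArithmeticFunction.moebius (k + 1) : ℤ) = 0 := by
            rcases ArithmeticFunction.moebius_eq_or (k + 1) with h0 | h0 | h0
            · exact h0
            · exact absurd h0 hμ1
            · exact absurd h0 hμ2
          have hμR : (ArithmeticFunction.moebius (k + 1) : ℝ) = 0 := by exact_mod_cast hμ0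
          rw [hμR, zero_mul, zero_div, add_zero]
          exact ⟨ih1, ih2⟩

/-- **The kernel test** at `N = 2000`: with `[nl, nh] ∋ 2⁸⁰ log 2000` and `W_lo ≤ 2⁸⁰ W`,
`0 < W_lo` and `0.0166 · nh² ≤ (2 − 2·(log 2)⁺²)·W_lo²`. -/
def levCheck : Bool :=
  match logIv 2000 with
  | some (nl, nh) =>
    match wAcc nl nh 2000 with
    | some (wlo, _) => decide (0 < wlo) && decide ((166 : ℚ) / 10000 * (nh : ℚ) ^ 2 ≤ (2 - 2 * QDigits.L2HIq ^ 2) * (wlo : ℚ) ^ 2)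
    | none => false
  | none => false

/-- The kernel test passes. -/
theorem levCheck_eq : levCheck = true := by
  decide +kernel

end LevinsonCert

open LevinsonCert

/-- **`0.0166 ≤ d²_2000(v_2000)` (RH-FREE, kernel-certified)** — the Levinson/BCF vector at `N = 2000` is at squared
distance at least `0.0166` from `χ` (certified optimum: `0.006114…`). -/
theorem nbDistSq_levinson_two_thousand_ge : (0.0166 : ℝ) ≤ nbDistSq 2000 (nbLevinsonVector 2000) := by
  have hchk := levCheck_eq
  unfold levCheck at hchk
  cases hL : logIv 2000 with
  | none => simp [hL] at hchk
  | some p =>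
    obtain ⟨nl, nh⟩ := p
    cases hW : wAcc nl nh 2000 with
    | none => simp [hL, hW] at hchk
    | some q =>
      obtain ⟨wlo, whi⟩ := q
      simp only [hL, hW, Bool.and_eq_true, decide_eq_true_eq] at hchk
      obtain ⟨hpos, hineq⟩ := hchk
      have hN := logIv_sound hL
      obtain ⟨hWlo, -⟩ := wAcc_sound hN 2000 hW
      -- make the kernel integers opaque
      have hposR : (0 : ℝ) < wlo := by exact_mod_cast hpos
      have hineqR := (Rat.cast_le (K := ℝ)).2 hineq
      push_cast at hineqR
      have hL2 : ((QDigits.L2HIq : ℚ) : ℝ) = 0.69314718055994530944 := by norm_num [QDigits.L2HIq]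
      rw [hL2] at hineqR
      clear hW hL hpos hineq
      -- the tail constant
      have hτ := nbLevinsonTailConst 2000 (by norm_num)
      set W := ∑ i ∈ Finset.range 2000,
          (ArithmeticFunction.moebius (i + 1) : ℝ) * (Real.log (2000 : ℕ) - Real.log ((i : ℝ) + 1)) / ((i : ℝ) + 1)
        with hWdef
      have hsum : ∑ k : Fin 2000, (ArithmeticFunction.moebius (k.val + 1) : ℝ) *
          Real.log (((2000 : ℕ) : ℝ) / ((k.val : ℝ) + 1)) / ((k.val : ℝ) + 1) = W := by
        rw [hWdef, Finset.sum_range]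
        refine Finset.sum_congr rfl fun k _ ↦ ?_
        rw [Real.log_div (by norm_num) (Nat.cast_add_one_pos _).ne']
      rw [hsum] at hτ
      -- `log 2000 > 0` and its enclosure
      set L := Real.log ((2000 : ℕ) : ℝ) with hLdef
      have hL0 : 0 < L := by rw [hLdef]; exact Real.log_pos (by norm_num)
      have hLhi : L ≤ (nh : ℝ) / 2 ^ 80 := hN.2
      have hWlo' : (wlo : ℝ) / 2 ^ 80 ≤ W := hWlo
      have hS : (0 : ℝ) < (2 : ℝ) ^ 80 := by positivity
      -- `τ² = W²/L² ≥ wlo²/nh²`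
      have hl2hi := Literature.Analysis.SpecialFunctions.Real.log_two_lt_d20
      have hl2lo := Literature.Analysis.SpecialFunctions.Real.log_two_gt_d20
      have hlog2sq : Real.log 2 ^ 2 ≤ (0.69314718055994530944 : ℝ) ^ 2 :=
        pow_le_pow_left₀ (by linarith) hl2hi.le 2
      have hbase := nbTailConstLeDist 2000 (nbLevinsonVector 2000)
      have hτsq : tailConst (nbLevinsonVector 2000) ^ 2 = W ^ 2 / L ^ 2 := by
        rw [hτ]; field_simp
      rw [hτsq] at hbase
      -- `W ≥ wlo/S > 0`, `L ≤ nh/S`, so `W²/L² ≥ (wlo/S)²/(nh/S)² = wlo²/nh²`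
      have hW0 : 0 < W := lt_of_lt_of_le (by positivity) hWlo'
      have hnh0 : 0 < (nh : ℝ) := by
        have : 0 < (nh : ℝ) / 2 ^ 80 := lt_of_lt_of_le hL0 hLhi
        exact (div_pos_iff_of_pos_right hS).1 this
      have hratio : (wlo : ℝ) ^ 2 / (nh : ℝ) ^ 2 ≤ W ^ 2 / L ^ 2 := by
        rw [div_le_div_iff₀ (pow_pos hnh0 2) (pow_pos hL0 2)]
        have h1 : (wlo : ℝ) * L ≤ W * (nh : ℝ) := by
          have hA : (wlo : ℝ) ≤ W * 2 ^ 80 := by rw [div_le_iff₀ hS] at hWlo'; exact hWlo'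
          have hB : L * 2 ^ 80 ≤ (nh : ℝ) := by rw [le_div_iff₀ hS] at hLhi; exact hLhi
          nlinarith [hW0, hL0]
        have h2 : 0 ≤ (wlo : ℝ) * L := by positivity
        nlinarith [h1, h2]
      -- conclude
      have hcoef : 0 ≤ 2 - 2 * Real.log 2 ^ 2 := by nlinarith [hl2hi, hl2lo]
      have hstep : (166 : ℝ) / 10000 ≤ (2 - 2 * (0.69314718055994530944 : ℝ) ^ 2) * ((wlo : ℝ) ^ 2 / (nh : ℝ) ^ 2) := by
        rw [← mul_div_assoc, le_div_iff₀ (pow_pos hnh0 2)]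
        linarith [hineqR]
      have hwn : 0 ≤ (wlo : ℝ) ^ 2 / (nh : ℝ) ^ 2 := div_nonneg (sq_nonneg _) (sq_nonneg _)
      calc (0.0166 : ℝ) = 166 / 10000 := by norm_num
        _ ≤ (2 - 2 * (0.69314718055994530944 : ℝ) ^ 2) * ((wlo : ℝ) ^ 2 / (nh : ℝ) ^ 2) := hstep
        _ ≤ (2 - 2 * Real.log 2 ^ 2) * ((wlo : ℝ) ^ 2 / (nh : ℝ) ^ 2) :=
            mul_le_mul_of_nonneg_right (by linarith) hwn
        _ ≤ (2 - 2 * Real.log 2 ^ 2) * (W ^ 2 / L ^ 2) := mul_le_mul_of_nonneg_left hratio hcoef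
        _ ≤ nbDistSq 2000 (nbLevinsonVector 2000) := hbase

/-- **Theory's T6 `NbLevinsonFarFromOptimal`, both conjuncts (RH-FREE, DISCHARGED):** `(2 − 2log²2)·tailConst(v_N)² ≤ d_N²(v_N)`
for every `N ≥ 2` (`nbTailConstLeDist`) and `0.0166 ≤ d²_2000(v_2000)`. -/
theorem nbLevinsonFarFromOptimal_holds :
    (∀ N : ℕ, 2 ≤ N →
        (2 - 2 * Real.log 2 ^ 2) * tailConst (nbLevinsonVector N) ^ 2 ≤ nbDistSq N (nbLevinsonVector N)) ∧
      (0.0166 : ℝ) ≤ nbDistSq 2000 (nbLevinsonVector 2000) :=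
  ⟨fun N _ ↦ nbTailConstLeDist N (nbLevinsonVector N), nbDistSq_levinson_two_thousand_ge⟩

end Summit.RiemannHypothesis.RiemannHypothesis.Theorems.NbTheory

end
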